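import Summits.BirchSwinnertonDyer.BirchSwinnertonDyer.Theorems.EisensteinPrimesGoodLatticeAnacongCharEulerElement
import Summits.BirchSwinnertonDyer.BirchSwinnertonDyer.Theorems.EisensteinPrimesGoodLatticeAnacongEulerCompPairing
import HarnessLib

/-!
# Content stub 3a-A of crux 2 `GoodLatticeBDPValue` from an EISENSTEIN CONGRUENCE of `p`-adic `L`-functions — the consumer:
# `3a-A's conclusion ⟸ (L ≡ U·𝓔²·L_φ² mod 𝔪, 𝓔 = ∏_{ℓ∣N₀N₋}𝒫(φ)·∏_{ℓ∣N₀N₊}𝒫(ψ), U ∈ R₀⟦T⟧ˣ) ∧ (μ(L_φ) = 0, λ(L_φ) = n_φ)`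
# (cell `bsd-eis`, width seat `bsd-line-x1-p1-w2` gen 26; `--supports stmt-BirchSwinnertonDyer-19032`)

WHY. Crux 2 [-19032] (line `halves` v33N) is closed BY NAME modulo five published facts and ONE content stub, 3a-A
`stub_anacongOfFullDescentDatum := KellerYin2024.thm222_anacong_goodLattice_of_fullDescentDatum` (CGLS 2022 Thms. 2.2.1/2.2.2 ∘
Kriz 2016 ∘ Hida 2010; label under referee C3). CGLS prove 2.2.2 from 2.2.1 by: the congruence, Hida's `μ(𝓛_φ) = 0` (tree fact
`Hida2010MuInvariant.thmI_mu_katzLFunction_eq_zero`, PUBLISHED), and the bookkeeping (eq:Euler-comp) + (2.16) — in the kernel in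
closed-form currency since -w2 g24 (`GoodLatticeAnacongEulerCompPairing.anacong_conclusion_iff_two_mul`). THIS FILE proves that a
congruence in the currency a typing of CGLS Thm. 2.2.1 (or of CGLS's PROOF of 2.2.1 from (eq:cong-mf)) would deliver — TOGETHER
WITH `μ(L_φ) = 0` — implies the conclusion of 3a-A at its own binders. So the preprint-grade atom of crux 2 reduces to
«a CGLS 2.2.1-shaped congruence» ∧ «Hida Thm. I» ∧ kernel (director-bsd key (β)); the congruence itself is NOT asserted here.
* §3 `firstUnitCoeffAt_eisensteinFactor` — ONE prime `ℓ ∣ N_E`: the factor `𝓔_ℓ = Pq^{[ℓ∣N₀N₋]}·Ps^{[ℓ∣N₀N₊]}` of an admissible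
  placement has `FirstUnitCoeffAt 𝓔_ℓ corr_ℓ`, `corr_ℓ = (split mult. ? [Γ:Γ_w] : mult. ? 0 : λ𝒫_w(θsub) + λ𝒫_w(θquot))`
  (residual pair's Frobenius scalars `{εℓ, ε}` at multiplicative `w`, -w2 g23/g24; additive `ℓ`: both characters enter).
* §4 `anacong_conclusion_of_eisensteinCongruence` — the displayed consumer.

HONEST FRAMING: CONDITIONAL on the congruence hypothesis `hcong` and on `FirstUnitCoeffAt Lφ nφ`, both hypotheses; 0 definitions,
0 named facts, 0 sorry; no `p`-adic `L`-function is constructed, no congruence asserted; closes no stub; 0 cells / labels / tiers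
move; no summit statement, no case of BSD, no theorem of CGLS / Kriz / Hida / Keller–Yin is proved here.
References: [CastellaGrossiLeeSkinner2022] Thm. 2.2.1 (thm:kriz), proof of Thm. 2.2.2 (cor:Kriz) (arXiv:2008.02571v2 TeX L1051–1153);
[GreenbergVatsal2000] §2 Prop. (2.4); [Kriz2016] Thm. 34 (2)(3); [Washington1997] §7.1 Prop. 7.2; [KellerYin2024] Thm. 2.2.2 (shape);
cell memos `SIZING-3aA-221-split-w2g22.md` §2–§4 (K-i/K-ii), `EULERCOMP-assembled-w2g24.md`.
-/

set_option autoImplicit false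
set_option linter.dupNamespace false

noncomputable section

open scoped Classical

open NumberField IsDedekindDomain Field WeierstrassCurve PowerSeries
  Literature.NumberTheory.EllipticCurves Literature.NumberTheory.GaloisRepresentations
  Literature.NumberTheory.EllipticCurves.GreenbergSelmer
  Literature.NumberTheory.EllipticCurves.Rank1Residual
  Literature.NumberTheory.EllipticCurves.KellerYin2024
  Summit.BirchSwinnertonDyer.Rank1Residual.X11b.Halves
  Summit.BirchSwinnertonDyer.Rank1Residual.X1.KellerYinHalves
  Summit.BirchSwinnertonDyer.BirchSwinnertonDyer.Theorems.GoodLatticeAnacongCharEulerElement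

namespace Summit.BirchSwinnertonDyer.BirchSwinnertonDyer.Theorems.GoodLatticeAnacongOfEisensteinCongruence

variable {p : ℕ} [hp : Fact p.Prime] {S : Set (PadicAlgCl p)}

/-! ## §3 ONE prime `ℓ ∣ N_E`: the CGLS factor `𝓔_ℓ` of an admissible placement has first unit coefficient at `corr_ℓ` -/

section Prime

/-- Two integers within distance `< 1` of the same element of `ℚ̄_p` are congruent mod `p`. [folklore] -/
theorem intCast_zmod_eq_of_norm_sub_lt {x : PadicAlgCl p} {m n : ℤ} (hm : ‖x - (m : PadicAlgCl p)‖ < 1)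
    (hn : ‖x - (n : PadicAlgCl p)‖ < 1) : (m : ZMod p) = (n : ZMod p) := by
  have h : ‖(m : PadicAlgCl p) - (n : PadicAlgCl p)‖ < 1 := by
    have e : (m : PadicAlgCl p) - (n : PadicAlgCl p) = ((m : PadicAlgCl p) - x) + (x - (n : PadicAlgCl p)) := by ring
    rw [e]
    refine (IsUltrametricDist.norm_add_le_max _ _).trans_lt (max_lt ?_ hn)
    rwa [norm_sub_rev]
  rw [show (m : PadicAlgCl p) - (n : PadicAlgCl p) = (((m - n : ℤ) : ℚ_[p]) : PadicAlgCl p) by push_cast; rfl,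
    PadicAlgCl.norm_extends, Padic.norm_intCast_lt_one_iff, ← ZMod.intCast_eq_intCast_iff_dvd_sub] at h
  exact h.symm

variable (W : WeierstrassCurve ℚ) [W.IsElliptic] [W.IsGloballyMinimal] (K : Type) [Field K] [NumberField K]

/-- **ONE PRIME — the first unit coefficient of the CGLS factor at `ℓ ∣ N_E`.** Binders of the content stub 3a-A (`W/ℚ`
globally minimal, `2 < p` good, `Red`, `Anom`, (hlat), `K` imaginary quadratic with (Heeg) for `N_E` and `p` split, `κ`
anticyclotomic, a residual pair `(θsub, θquot) = (ψ, φ)` of `E[p]` over `K`), a prime `ℓ ∣ N_E` with a chosen place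
`w ∋ ℓ`, local Euler elements `Pq` of `φ = θquot` and `Ps` of `ψ = θsub` at `w` (each `1 − u·(1+T)^{±c_w}` with
`u·ℓ ≡ θ(Frob_w)`, or `1` if `θ` is ramified at `w`), and the PLACEMENT of `ℓ` in CGLS's factorisation `N = N₀N₊N₋`: `inq` =
«`ℓ ∣ N₀N₋`» (the `φ`-factor enters `𝓔_{φ,ψ}`), `ins` = «`ℓ ∣ N₀N₊`» (the `ψ`-factor enters), with an additive `ℓ` in `N₀`
(both enter), a multiplicative `ℓ` in exactly one of `N₊` (`a_ℓ ≡ φ(ℓ)`), `N₋` (`a_ℓ ≡ ψ(ℓ)`), `a_ℓ = ±1` the split/non-split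
sign. THEN the factor `𝓔_ℓ = Pq^{[inq]} · Ps^{[ins]}` has `μ = 0` and first unit coefficient at
`corr_ℓ = (split mult. ? [Γ:Γ_w] : mult. ? 0 : λ𝒫_w(θsub) + λ𝒫_w(θquot))` — CGLS's (eq:Euler-comp) bookkeeping «using the
congruence relations in Theorem 2.2.1», by the residual pair's Frobenius scalars `{εℓ, ε}` at multiplicative `w` (-w2 g23/g24
`residualPair_frob_scalars_of_hasMultiplicativeReductionAtPrime'`). [cite: CastellaGrossiLeeSkinner2022, Thm. 2.2.1 (the factorisation N/N₀ = N₊N₋ and 𝓔_{φ,ψ}) and proof of Thm. 2.2.2 (eq:Euler-comp)]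
[cite: GreenbergVatsal2000, §2 Prop. (2.4), pp. 14–15] [cite: Kriz2016, Thm. 34 (2)(3)] -/
theorem firstUnitCoeffAt_eisensteinFactor (hp2 : 2 < p) (hgood : Good W p) (hred : Red W p) (hanom : Anom W p)
    (hlat : ∀ Φ : AddSubgroup (geomTorsion W (p : ℤ)), IsRationalLine W p Φ → ¬ LineUnramifiedAt W p Φ)
    (hK : IsImaginaryQuadratic K) (hH : SatisfiesHeegnerHypothesis (W.conductorNorm ℤ) K)
    (hHp : SatisfiesHeegnerHypothesis p K) {κ : ZpExtension K p} (hκ : κ.IsAnticyclotomic)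
    {θsub θquot : FramedGaloisRep K (padicCoeffIntegers S) 1} (h : IsResidualPairOver (W.baseChange K) p θsub θquot)
    {ℓ : ℕ} (hℓN : ℓ ∈ (W.conductorNorm ℤ).primeFactors) {w : HeightOneSpectrum (𝓞 K)}
    (hw : ((ℓ : ℕ) : 𝓞 K) ∈ w.asIdeal) {Pq Ps : UnrSeries p}
    (hPq₁ : ¬ θquot.IsUnramifiedAt w → Pq = 1)
    (hPq₂ : θquot.IsUnramifiedAt w → ∃ (a : padicCoeffIntegers S) (u : unrIntegers p) (b : ℤ_[p]),
      θquot.HasFrobCharpolyAt w (Polynomial.X - Polynomial.C a) ∧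
        ‖(u : ℂ_[p]) * (ℓ : ℂ_[p]) - ((a : PadicAlgCl p) : ℂ_[p])‖ < 1 ∧
        (b = κ.frobExponentAt w ∨ b = -κ.frobExponentAt w) ∧ Pq = 1 - C u * (binomialSeries ℤ_[p] b).map (toUnr p))
    (hPs₁ : ¬ θsub.IsUnramifiedAt w → Ps = 1)
    (hPs₂ : θsub.IsUnramifiedAt w → ∃ (a : padicCoeffIntegers S) (u : unrIntegers p) (b : ℤ_[p]),
      θsub.HasFrobCharpolyAt w (Polynomial.X - Polynomial.C a) ∧
        ‖(u : ℂ_[p]) * (ℓ : ℂ_[p]) - ((a : PadicAlgCl p) : ℂ_[p])‖ < 1 ∧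
        (b = κ.frobExponentAt w ∨ b = -κ.frobExponentAt w) ∧ Ps = 1 - C u * (binomialSeries ℤ_[p] b).map (toUnr p))
    (inq ins : Prop) [Decidable inq] [Decidable ins]
    (hinq : ¬ W.HasMultiplicativeReductionAt (w.under (𝓞 ℚ)) → inq)
    (hins : ¬ W.HasMultiplicativeReductionAt (w.under (𝓞 ℚ)) → ins)
    (hqs : W.HasMultiplicativeReductionAt (w.under (𝓞 ℚ)) → (ins ↔ ¬ inq))
    (hplus : W.HasMultiplicativeReductionAt (w.under (𝓞 ℚ)) → ins → ∃ a : padicCoeffIntegers S,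
      θquot.HasFrobCharpolyAt w (Polynomial.X - Polynomial.C a) ∧
        ‖(a : PadicAlgCl p) - (if W.HasSplitMultiplicativeReductionAt (w.under (𝓞 ℚ)) then (1 : PadicAlgCl p) else -1)‖ < 1)
    (hminus : W.HasMultiplicativeReductionAt (w.under (𝓞 ℚ)) → inq → ∃ a : padicCoeffIntegers S,
      θsub.HasFrobCharpolyAt w (Polynomial.X - Polynomial.C a) ∧
        ‖(a : PadicAlgCl p) - (if W.HasSplitMultiplicativeReductionAt (w.under (𝓞 ℚ)) then (1 : PadicAlgCl p) else -1)‖ < 1) :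
    FirstUnitCoeffAt ((if inq then Pq else 1) * (if ins then Ps else 1))
      (if W.HasSplitMultiplicativeReductionAt (w.under (𝓞 ℚ)) then numPlacesAbove κ w
        else if W.HasMultiplicativeReductionAt (w.under (𝓞 ℚ)) then 0
        else charLocalLambda S κ θsub w + charLocalLambda S κ θquot w) := by
  have hpp := hp.out
  -- the prime `ℓ ∣ N_E`, `ℓ ≠ p`, the place `w ∋ ℓ` has degree one (Heegner)
  have hℓ : ℓ.Prime := Nat.prime_of_mem_primeFactors hℓN
  haveI hℓfact : Fact ℓ.Prime := ⟨hℓ⟩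
  have hℓdvd : ℓ ∣ W.conductorNorm ℤ := Nat.dvd_of_mem_primeFactors hℓN
  have hpN : ¬ p ∣ W.conductorNorm ℤ := not_dvd_conductorNorm_of_hasGoodReductionAtPrime W hgood
  have hℓp : ℓ ≠ p := fun h' ↦ hpN (h' ▸ hℓdvd)
  obtain ⟨he, hf⟩ := Summit.BirchSwinnertonDyer.Rank1Residual.X11b.degreeOne_of_splitsIn hK.1 (hH ℓ hℓ hℓdvd) hw
  -- the two local elements
  have hFq : FirstUnitCoeffAt Pq (charLocalLambda S κ θquot w) := by
    by_cases hunr : θquot.IsUnramifiedAt w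
    · obtain ⟨a, u, b, ha, hu, hb, hP⟩ := hPq₂ hunr
      rw [hP]
      exact firstUnitCoeffAt_charEulerElement hK hp2 hκ hunr hℓ hℓp hw he hf ha hu hb
    · rw [hPq₁ hunr]
      exact firstUnitCoeffAt_one_of_not_isUnramifiedAt κ hunr
  have hFs : FirstUnitCoeffAt Ps (charLocalLambda S κ θsub w) := by
    by_cases hunr : θsub.IsUnramifiedAt w
    · obtain ⟨a, u, b, ha, hu, hb, hP⟩ := hPs₂ hunr
      rw [hP]
      exact firstUnitCoeffAt_charEulerElement hK hp2 hκ hunr hℓ hℓp hw he hf ha hu hb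
    · rw [hPs₁ hunr]
      exact firstUnitCoeffAt_one_of_not_isUnramifiedAt κ hunr
  by_cases hmult : W.HasMultiplicativeReductionAt (w.under (𝓞 ℚ))
  · -- MULTIPLICATIVE `ℓ`: a Frobenius above `w`, unramifiedness, the scalars `{εℓ, ε}`
    have hℓv : ((ℓ : ℕ) : 𝓞 ℚ) ∈ (w.under (𝓞 ℚ)).asIdeal := by
      change ((ℓ : ℕ) : 𝓞 ℚ) ∈ w.asIdeal.comap (algebraMap (𝓞 ℚ) (𝓞 K))
      rw [Ideal.mem_comap, map_natCast]; exact hw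
    have hvℓ : ((Rat.HeightOneSpectrum.primesEquiv (w.under (𝓞 ℚ)) : Nat.Primes) : ℕ) = ℓ :=
      Rat.HeightOneSpectrum.primesEquiv_eq_of_natCast_mem _ hℓ hℓv
    have hmultℓ : W.HasMultiplicativeReductionAtPrime ℓ := by
      have key : ∀ (q : ℕ) (hq' : Fact q.Prime), q = ℓ →
          (haveI := hq'; W.HasMultiplicativeReductionAtPrime q) → W.HasMultiplicativeReductionAtPrime ℓ := by
        rintro q hq' rfl h''; exact h''
      exact key _ _ hvℓ ((W.hasMultiplicativeReductionAtPrime_iff_hasMultiplicativeReductionAt_ringOfIntegers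
        (w.under (𝓞 ℚ))).mpr hmult)
    have hsplit_iff : W.HasSplitMultiplicativeReductionAtPrime ℓ ↔ W.HasSplitMultiplicativeReductionAt (w.under (𝓞 ℚ)) := by
      have key : ∀ (q : ℕ) (hq' : Fact q.Prime), q = ℓ →
          ((haveI := hq'; W.HasSplitMultiplicativeReductionAtPrime q) ↔ W.HasSplitMultiplicativeReductionAtPrime ℓ) := by
        rintro q hq' rfl; exact Iff.rfl
      rw [← key _ _ hvℓ]
      exact WeierstrassCurve.hasSplitMultiplicativeReductionAtPrime_iff_hasSplitMultiplicativeReductionAt W (w.under (𝓞 ℚ))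
    obtain ⟨𝔓, h𝔓⟩ := HeightOneSpectrum.primesAbove_nonempty w
    obtain ⟨σ₀, hσ₀⟩ := HeightOneSpectrum.exists_isArithFrobAt_of_mem_primesAbove_holds h𝔓
    obtain ⟨hunr_sub, hunr_quot⟩ :=
      ResidualPairUnramifiedAtMultiplicative.isUnramifiedAt_baseChange_of_hasMultiplicativeReductionAtPrime W h hℓp hmultℓ hw
    obtain ⟨a, b, ha, hb, hsplit, hns⟩ :=
      GoodLatticeResidualPairScalarsAtMultiplicativeAll.residualPair_frob_scalars_of_hasMultiplicativeReductionAtPrime' W K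
        hp2 hred hanom hlat hK hHp h hℓp hmultℓ hw hf h𝔓 hσ₀
    have hN : Ideal.absNorm w.asIdeal = ℓ := GoodLatticeAnacongEulerCompMultiplicative.absNorm_eq_of_inertiaDeg_eq_one hℓ hw hf
    have hsubiff := GoodLatticeAnacongEulerCompMultiplicative.frobActsAsNormAt_iff_intCast_eq hunr_sub h𝔓 hσ₀ ha hN
    have hquotiff := GoodLatticeAnacongEulerCompMultiplicative.frobActsAsNormAt_iff_intCast_eq hunr_quot h𝔓 hσ₀ hb hN
    -- arithmetic mod `p`
    have hℓ0 : (ℓ : ZMod p) ≠ 0 := by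
      rw [Ne, ZMod.natCast_eq_zero_iff]
      exact fun h' ↦ hℓp ((Nat.prime_dvd_prime_iff_eq hpp hℓ).mp h').symm
    have h2ne : (2 : ZMod p) ≠ 0 := by
      intro h2
      have h2' : ((2 : ℕ) : ZMod p) = 0 := by exact_mod_cast h2
      rw [ZMod.natCast_eq_zero_iff] at h2'
      have := (Nat.prime_dvd_prime_iff_eq hpp Nat.prime_two).mp h2'
      omega
    have hnegℓ : ¬ (-(ℓ : ZMod p) = (ℓ : ZMod p)) := by
      intro hneg
      have h2ℓ : (2 : ZMod p) * (ℓ : ZMod p) = 0 := by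
        rw [two_mul]; nth_rewrite 1 [← hneg]; rw [neg_add_cancel]
      rcases mul_eq_zero.mp h2ℓ with h' | h'
      · exact h2ne h'
      · exact hℓ0 h'
    have hneg1 : ¬ ((-1 : ZMod p) = 1) := by
      intro hneg
      apply h2ne
      have : (1 : ZMod p) + 1 = 0 := by nth_rewrite 1 [← hneg]; rw [neg_add_cancel]
      rwa [← two_mul, mul_one] at this
    -- the sign `ε = a_ℓ`
    have hεZ : ∀ {θ : FramedGaloisRep K (padicCoeffIntegers S) 1}, θ.IsUnramifiedAt w → ∀ {c : ℤ},
        ‖((KellerYin2024.entry S θ σ₀ : padicCoeffIntegers S) : PadicAlgCl p) - (c : PadicAlgCl p)‖ < 1 →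
        (∃ a' : padicCoeffIntegers S, θ.HasFrobCharpolyAt w (Polynomial.X - Polynomial.C a') ∧
          ‖(a' : PadicAlgCl p) - (if W.HasSplitMultiplicativeReductionAt (w.under (𝓞 ℚ)) then (1 : PadicAlgCl p) else -1)‖ < 1) →
        (c : ZMod p) = if W.HasSplitMultiplicativeReductionAt (w.under (𝓞 ℚ)) then 1 else -1 := by
      intro θ hunr c hc hex
      obtain ⟨a', ha', hε⟩ := hex
      have hea : a' = KellerYin2024.entry S θ σ₀ := by
        have hu := FramedGaloisRep.HasFrobCharpolyAt.unique ha'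
          (GoodLatticeAnacongEulerCompMultiplicative.hasFrobCharpolyAt_entry hunr h𝔓 hσ₀)
        rwa [sub_right_inj, Polynomial.C_inj] at hu
      rw [hea] at hε
      by_cases hsp : W.HasSplitMultiplicativeReductionAt (w.under (𝓞 ℚ))
      · rw [if_pos hsp] at hε ⊢
        have h1 : ((1 : ℤ) : ZMod p) = 1 := Int.cast_one
        rw [← h1]
        refine intCast_zmod_eq_of_norm_sub_lt hc ?_
        rwa [Int.cast_one]
      · rw [if_neg hsp] at hε ⊢
        have h1 : ((-1 : ℤ) : ZMod p) = -1 := by rw [Int.cast_neg, Int.cast_one]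
        rw [← h1]
        refine intCast_zmod_eq_of_norm_sub_lt hc ?_
        rwa [Int.cast_neg, Int.cast_one]
    by_cases hi : ins
    · -- `ℓ ∣ N₊`: the factor is `Ps`, `a_ℓ ≡ φ(ℓ) = θquot(Frob_w)`
      have hnq : ¬ inq := (hqs hmult).mp hi
      rw [if_neg hnq, if_pos hi, one_mul]
      have hbε := hεZ hunr_quot hb (hplus hmult hi)
      by_cases hsp : W.HasSplitMultiplicativeReductionAt (w.under (𝓞 ℚ))
      · rw [if_pos hsp]
        rw [if_pos hsp] at hbε
        -- `(a, b) ∈ {(ℓ, 1), (1, ℓ)}` and `b ≡ 1` ⟹ `a ≡ ℓ`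
        have haℓ : (a : ZMod p) = (ℓ : ZMod p) := by
          rcases hsplit (hsplit_iff.mpr hsp) with ⟨h1, -⟩ | ⟨h1, h2⟩
          · exact h1
          · rw [h1, ← hbε, h2]
        rwa [charLocalLambda_of_frobActsAsNormAt S κ θsub w (hsubiff.mpr haℓ)] at hFs
      · rw [if_neg hsp, if_pos hmult]
        rw [if_neg hsp] at hbε
        have hnsℓ : ¬ W.HasSplitMultiplicativeReductionAtPrime ℓ := fun h' ↦ hsp (hsplit_iff.mp h')
        -- `(a, b) ∈ {(−ℓ, −1), (−1, −ℓ)}` and `b ≡ −1` ⟹ `a ≢ ℓ`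
        have haℓ : (a : ZMod p) ≠ (ℓ : ZMod p) := by
          rcases hns hnsℓ with ⟨h1, -⟩ | ⟨h1, h2⟩
          · rw [h1]; exact hnegℓ
          · -- `−ℓ ≡ −1`, so `ℓ ≡ 1`, and `a ≡ −1 ≢ 1 ≡ ℓ`
            have hℓ1 : (ℓ : ZMod p) = 1 := by
              have := h2.symm.trans hbε
              rwa [neg_inj] at this
            rw [h1, hℓ1]; exact hneg1
        rwa [charLocalLambda_of_not_frobActsAsNormAt S κ θsub w (fun h' ↦ haℓ (hsubiff.mp h'))] at hFs
    · -- `ℓ ∣ N₋`: the factor is `Pq`, `a_ℓ ≡ ψ(ℓ) = θsub(Frob_w)`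
      have hq : inq := by
        by_contra hq; exact hi ((hqs hmult).mpr hq)
      rw [if_pos hq, if_neg hi, mul_one]
      have haε := hεZ hunr_sub ha (hminus hmult hq)
      by_cases hsp : W.HasSplitMultiplicativeReductionAt (w.under (𝓞 ℚ))
      · rw [if_pos hsp]
        rw [if_pos hsp] at haε
        have hbℓ : (b : ZMod p) = (ℓ : ZMod p) := by
          rcases hsplit (hsplit_iff.mpr hsp) with ⟨h1, h2⟩ | ⟨-, h2⟩
          · rw [h2, ← haε, h1]
          · exact h2
        rwa [charLocalLambda_of_frobActsAsNormAt S κ θquot w (hquotiff.mpr hbℓ)] at hFq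
      · rw [if_neg hsp, if_pos hmult]
        rw [if_neg hsp] at haε
        have hnsℓ : ¬ W.HasSplitMultiplicativeReductionAtPrime ℓ := fun h' ↦ hsp (hsplit_iff.mp h')
        have hbℓ : (b : ZMod p) ≠ (ℓ : ZMod p) := by
          rcases hns hnsℓ with ⟨h1, h2⟩ | ⟨-, h2⟩
          · have hℓ1 : (ℓ : ZMod p) = 1 := by
              have := h1.symm.trans haε
              rwa [neg_inj] at this
            rw [h2, hℓ1]; exact hneg1
          · rw [h2]; exact hnegℓ
        rwa [charLocalLambda_of_not_frobActsAsNormAt S κ θquot w (fun h' ↦ hbℓ (hquotiff.mp h'))] at hFq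
  · -- ADDITIVE `ℓ`: both factors enter
    have hns : ¬ W.HasSplitMultiplicativeReductionAt (w.under (𝓞 ℚ)) := fun h' ↦ hmult h'.hasMultiplicativeReductionAt
    rw [if_pos (hinq hmult), if_pos (hins hmult), if_neg hns, if_neg hmult, add_comm]
    exact firstUnitCoeffAt_mul hFq hFs

end Prime

/-! ## §4 The consumer at the binders of the content stub 3a-A -/

section Main

variable (W : WeierstrassCurve ℚ) [W.IsElliptic] [W.IsGloballyMinimal] (K : Type) [Field K] [NumberField K]

/-- **3a-A's CONCLUSION FROM AN EISENSTEIN CONGRUENCE OF `p`-ADIC `L`-FUNCTIONS (CGLS Thm. 2.2.1-shaped) AND `μ(L_φ) = 0`.**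
Binders of the content stub `stub_anacongOfFullDescentDatum` of crux 2 (`W/ℚ` globally minimal, `2 < p` of good reduction,
`Red`, `Anom`, (hlat), `K` imaginary quadratic with (Heeg) for `N_E` and `p` split, `κ` anticyclotomic, a residual pair
`(θsub, θquot) = (ψ, φ)` of `E[p]` over `K`, `Sf = {w : N_E ∈ w}`), plus the DATA a typing of Castella–Grossi–Lee–Skinner
Thm. 2.2.1 delivers — an admissible factorisation of the bad primes `N_E = N₀ N₊ N₋` (`N₀` = the additive primes; each
multiplicative `ℓ` in exactly one of `N₊`, `N₋`, with `a_ℓ ≡ φ(ℓ)` on `N₊` and `a_ℓ ≡ ψ(ℓ)` on `N₋`, `a_ℓ = ±1` the split sign,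
read at an arithmetic Frobenius of the chosen place `w_ℓ ∋ ℓ`), the local Euler elements `Pq ℓ = 𝒫_{w_ℓ}(φ)^{±ι}`,
`Ps ℓ = 𝒫_{w_ℓ}(ψ)^{±ι}` (`1 − u·(1+T)^{±c_w}`, `u·ℓ ≡ θ(Frob_w)`; `= 1` where `θ` ramifies), `𝓔 = ∏_{ℓ∣N₀N₋} Pq ℓ · ∏_{ℓ∣N₀N₊} Ps ℓ`,
and the CONGRUENCE `L ≡ U·𝓔²·L_φ²` coefficientwise modulo the maximal ideal of `R₀` for some unit `U ∈ R₀⟦T⟧ˣ` — and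
`μ(L_φ) = 0` with `λ(L_φ) = n_φ` (`FirstUnitCoeffAt Lφ nφ`; Hida 2010 Thm. I, tree fact
`Hida2010MuInvariant.thmI_mu_katzLFunction_eq_zero`). CONCLUSION: `μ(L) = 0` and
`λ(L) + Σ_{w∈Sf} λ𝒫_w(E) = 2·n_φ + Σ_{w∈Sf} (λ𝒫_w(θsub) + λ𝒫_w(θquot))` — verbatim the conclusion of
`KellerYin2024.thm222_anacong_goodLattice_of_fullDescentDatum` at these binders. This is CGLS's proof of Thm. 2.2.2 from
Thm. 2.2.1 ((eq:Euler-comp), (2.16) folded as `2·n_φ`), in the kernel. [cite: CastellaGrossiLeeSkinner2022, Thm. 2.2.1 (thm:kriz) and proof of Thm. 2.2.2 (cor:Kriz) (arXiv:2008.02571v2 TeX L1051–1153)]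
[cite: KellerYin2024, Thm. 2.2.2 (anacong; arXiv:2402.12781v2 TeX L1445–1448) — statement shape] [cite: GreenbergVatsal2000, §2 Prop. (2.4)]
[cite: Washington1997, §7.1 Prop. 7.2] -/
theorem anacong_conclusion_of_eisensteinCongruence (hp2 : 2 < p) (hgood : Good W p) (hred : Red W p)
    (hanom : Anom W p)
    (hlat : ∀ Φ : AddSubgroup (geomTorsion W (p : ℤ)), IsRationalLine W p Φ → ¬ LineUnramifiedAt W p Φ)
    (hK : IsImaginaryQuadratic K) (hH : SatisfiesHeegnerHypothesis (W.conductorNorm ℤ) K)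
    (hHp : SatisfiesHeegnerHypothesis p K) {κ : ZpExtension K p} (hκ : κ.IsAnticyclotomic)
    {θsub θquot : FramedGaloisRep K (padicCoeffIntegers S) 1} (h : IsResidualPairOver (W.baseChange K) p θsub θquot)
    (Sf : Finset (HeightOneSpectrum (𝓞 K)))
    (hSf : ∀ w : HeightOneSpectrum (𝓞 K), w ∈ Sf ↔ ((W.conductorNorm ℤ : ℤ) : 𝓞 K) ∈ w.asIdeal)
    -- a place above each `ℓ ∣ N_E` and the admissible factorisation `N_E = N₀ N₊ N₋`
    (wl : ℕ → HeightOneSpectrum (𝓞 K))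
    (hwl : ∀ ℓ ∈ (W.conductorNorm ℤ).primeFactors, ((ℓ : ℕ) : 𝓞 K) ∈ (wl ℓ).asIdeal)
    (Nzero Nplus Nminus : Finset ℕ) (hNz : Nzero ⊆ (W.conductorNorm ℤ).primeFactors)
    (hNp : Nplus ⊆ (W.conductorNorm ℤ).primeFactors) (hNm : Nminus ⊆ (W.conductorNorm ℤ).primeFactors)
    (hzero : ∀ ℓ ∈ (W.conductorNorm ℤ).primeFactors,
      ℓ ∈ Nzero ↔ ¬ W.HasMultiplicativeReductionAt ((wl ℓ).under (𝓞 ℚ)))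
    (hpm : ∀ ℓ ∈ (W.conductorNorm ℤ).primeFactors,
      W.HasMultiplicativeReductionAt ((wl ℓ).under (𝓞 ℚ)) → (ℓ ∈ Nplus ↔ ℓ ∉ Nminus))
    (hplus : ∀ ℓ ∈ Nplus, W.HasMultiplicativeReductionAt ((wl ℓ).under (𝓞 ℚ)) → ∃ a : padicCoeffIntegers S,
      θquot.HasFrobCharpolyAt (wl ℓ) (Polynomial.X - Polynomial.C a) ∧
        ‖(a : PadicAlgCl p) -
          (if W.HasSplitMultiplicativeReductionAt ((wl ℓ).under (𝓞 ℚ)) then (1 : PadicAlgCl p) else -1)‖ < 1)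
    (hminus : ∀ ℓ ∈ Nminus, W.HasMultiplicativeReductionAt ((wl ℓ).under (𝓞 ℚ)) → ∃ a : padicCoeffIntegers S,
      θsub.HasFrobCharpolyAt (wl ℓ) (Polynomial.X - Polynomial.C a) ∧
        ‖(a : PadicAlgCl p) -
          (if W.HasSplitMultiplicativeReductionAt ((wl ℓ).under (𝓞 ℚ)) then (1 : PadicAlgCl p) else -1)‖ < 1)
    -- the local Euler elements of `φ = θquot` and `ψ = θsub` at the chosen places
    (Pq Ps : ℕ → UnrSeries p)
    (hPq₁ : ∀ ℓ ∈ (W.conductorNorm ℤ).primeFactors, ¬ θquot.IsUnramifiedAt (wl ℓ) → Pq ℓ = 1)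
    (hPq₂ : ∀ ℓ ∈ (W.conductorNorm ℤ).primeFactors, θquot.IsUnramifiedAt (wl ℓ) →
      ∃ (a : padicCoeffIntegers S) (u : unrIntegers p) (b : ℤ_[p]),
        θquot.HasFrobCharpolyAt (wl ℓ) (Polynomial.X - Polynomial.C a) ∧
        ‖(u : ℂ_[p]) * (ℓ : ℂ_[p]) - ((a : PadicAlgCl p) : ℂ_[p])‖ < 1 ∧
        (b = κ.frobExponentAt (wl ℓ) ∨ b = -κ.frobExponentAt (wl ℓ)) ∧
        Pq ℓ = 1 - C u * (binomialSeries ℤ_[p] b).map (toUnr p))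
    (hPs₁ : ∀ ℓ ∈ (W.conductorNorm ℤ).primeFactors, ¬ θsub.IsUnramifiedAt (wl ℓ) → Ps ℓ = 1)
    (hPs₂ : ∀ ℓ ∈ (W.conductorNorm ℤ).primeFactors, θsub.IsUnramifiedAt (wl ℓ) →
      ∃ (a : padicCoeffIntegers S) (u : unrIntegers p) (b : ℤ_[p]),
        θsub.HasFrobCharpolyAt (wl ℓ) (Polynomial.X - Polynomial.C a) ∧
        ‖(u : ℂ_[p]) * (ℓ : ℂ_[p]) - ((a : PadicAlgCl p) : ℂ_[p])‖ < 1 ∧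
        (b = κ.frobExponentAt (wl ℓ) ∨ b = -κ.frobExponentAt (wl ℓ)) ∧
        Ps ℓ = 1 - C u * (binomialSeries ℤ_[p] b).map (toUnr p))
    -- the congruence `L ≡ U·𝓔²·L_φ² (mod 𝔪)` and `μ(L_φ) = 0`, `λ(L_φ) = n_φ`
    {L Lφ U : UnrSeries p} (hU : IsUnit U) {nφ : ℕ} (hφ : FirstUnitCoeffAt Lφ nφ)
    (hcong : ∀ i : ℕ, ‖((coeff i L : unrIntegers p) : ℂ_[p]) -
      ((coeff i (U * ((∏ ℓ ∈ Nzero ∪ Nminus, Pq ℓ) * (∏ ℓ ∈ Nzero ∪ Nplus, Ps ℓ)) ^ 2 * Lφ ^ 2) : unrIntegers p) :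
        ℂ_[p])‖ < 1) :
    ∃ n : ℕ, FirstUnitCoeffAt L n ∧
      n + ∑ w ∈ Sf, curveLocalLambda κ (W.baseChange K) w =
        2 * nφ + ∑ w ∈ Sf, (charLocalLambda S κ θsub w + charLocalLambda S κ θquot w) := by
  set PF := (W.conductorNorm ℤ).primeFactors with hPF
  -- the closed-form exponent of the factor at `ℓ`
  let corr : ℕ → ℕ := fun ℓ ↦
    if W.HasSplitMultiplicativeReductionAt ((wl ℓ).under (𝓞 ℚ)) then numPlacesAbove κ (wl ℓ)
      else if W.HasMultiplicativeReductionAt ((wl ℓ).under (𝓞 ℚ)) then 0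
      else charLocalLambda S κ θsub (wl ℓ) + charLocalLambda S κ θquot (wl ℓ)
  -- the factor at `ℓ`, with both memberships as `if`s
  let Efac : ℕ → UnrSeries p := fun ℓ ↦
    (if ℓ ∈ Nzero ∪ Nminus then Pq ℓ else 1) * (if ℓ ∈ Nzero ∪ Nplus then Ps ℓ else 1)
  -- §3 at every `ℓ ∣ N_E`
  have hfac : ∀ ℓ ∈ PF, FirstUnitCoeffAt (Efac ℓ) (corr ℓ) := by
    intro ℓ hℓ
    refine firstUnitCoeffAt_eisensteinFactor W K hp2 hgood hred hanom hlat hK hH hHp hκ h hℓ (hwl ℓ hℓ)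
      (hPq₁ ℓ hℓ) (hPq₂ ℓ hℓ) (hPs₁ ℓ hℓ) (hPs₂ ℓ hℓ) (ℓ ∈ Nzero ∪ Nminus) (ℓ ∈ Nzero ∪ Nplus)
      (fun hm ↦ Finset.mem_union_left _ ((hzero ℓ hℓ).mpr hm))
      (fun hm ↦ Finset.mem_union_left _ ((hzero ℓ hℓ).mpr hm)) (fun hm ↦ ?_) (fun hm hins ↦ ?_) (fun hm hinq ↦ ?_)
    · have hz : ℓ ∉ Nzero := fun hz ↦ (hzero ℓ hℓ).mp hz hm
      rw [Finset.mem_union, Finset.mem_union]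
      constructor
      · rintro (hz' | hp') 
        · exact absurd hz' hz
        · rintro (hz' | hm')
          · exact hz hz'
          · exact ((hpm ℓ hℓ hm).mp hp') hm'
      · intro hn
        exact Or.inr ((hpm ℓ hℓ hm).mpr (fun hm' ↦ hn (Or.inr hm')))
    · have hz : ℓ ∉ Nzero := fun hz ↦ (hzero ℓ hℓ).mp hz hm
      have hp' : ℓ ∈ Nplus := by
        rcases Finset.mem_union.mp hins with hz' | hp'
        · exact absurd hz' hz
        · exact hp'
      exact hplus ℓ hp' hm
    · have hz : ℓ ∉ Nzero := fun hz ↦ (hzero ℓ hℓ).mp hz hm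
      have hm' : ℓ ∈ Nminus := by
        rcases Finset.mem_union.mp hinq with hz' | hm'
        · exact absurd hz' hz
        · exact hm'
      exact hminus ℓ hm' hm
  -- the whole factor `𝓔`
  have hE : FirstUnitCoeffAt (∏ ℓ ∈ PF, Efac ℓ) (∑ ℓ ∈ PF, corr ℓ) :=
    SigmaFactorFU.firstUnitCoeffAt_prod PF Efac corr hfac
  have hprod : (∏ ℓ ∈ Nzero ∪ Nminus, Pq ℓ) * (∏ ℓ ∈ Nzero ∪ Nplus, Ps ℓ) = ∏ ℓ ∈ PF, Efac ℓ := by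
    rw [Finset.prod_mul_distrib, Finset.prod_ite_mem, Finset.prod_ite_mem,
      Finset.inter_eq_right.mpr (Finset.union_subset hNz hNm), Finset.inter_eq_right.mpr (Finset.union_subset hNz hNp)]
  -- the congruence transfers `μ = 0` and the index
  rw [hprod] at hcong
  have hL : FirstUnitCoeffAt L (2 * (∑ ℓ ∈ PF, corr ℓ + nφ)) :=
    firstUnitCoeffAt_of_congr_unit_mul_sq_mul_sq hU hE hφ hcong
  refine ⟨2 * (∑ ℓ ∈ PF, corr ℓ + nφ), hL, ?_⟩
  rw [GoodLatticeAnacongEulerCompPairing.anacong_conclusion_iff_two_mul W K hp2 hgood hred hanom hlat hK hH hHp hκ h Sf hSf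
    wl hwl]
  rw [add_comm]

end Main

end Summit.BirchSwinnertonDyer.BirchSwinnertonDyer.Theorems.GoodLatticeAnacongOfEisensteinCongruence

end
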